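import Summits.AtomisticToContinuum.Crystallization.Theorems.ThreeConeCertificateExactCertificateFieldSummable
import Summits.AtomisticToContinuum.Crystallization.Theorems.ThreeConeCertificateExactCertificateNoGapNecessary

/-!
# `ExactCertificate` (stmt-AtomisticToContinuum-11959): the three-cone programme has NO
# ASYMPTOTIC DUALITY GAP, II — from a cheap Bochner cone to a near-optimal split (kernel-agnostic)

Line `closure-makes-nogap-exact`, continuation lead c2 (registered stub `stub_splitOfKernel` of the crux item;
the specific kernels are part I = `…AsymptoticKernel`, c1 lead, p107933; the assembly `stub_asymptoticNoGap` is
part III = `…AsymptoticNoGap`).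

**Theorem (`stub_splitOfKernel` / `exists_split_of_kernel`).**  Let `ρ ≥ 1000` and let `f` be radially of
positive type on `ℝ³` with small charge `f 0 ≤ 135/ρ³`, `f ≤ 0` on `[ρ^{1/4}, ρ]` and `f ≤ V_LJ` on `[ρ,∞)`.
Then `g := (V_LJ − f)·1_{(0,ρ)}`, `U := (V_LJ − f)·1_{[ρ,∞)} ≥ 0` form a range-`ρ` three-cone split
(`IsSplit ρ c g U f`) of value `c + f 0/2 ≤ −e* + K/ρ`, `K = 8·810·2³²/12 + 135`.  So every family of such cones
with charge `O(ρ⁻³)` drives the three-cone value to its floor `−e*` (`IsSplit.value_ge`): no ASYMPTOTIC duality gap.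

STABILITY OF `g` (`stable_of_kernel`): with `μ := 810/ρ^{3/2} ≤ 1` and the softer Lennard-Jones potential
`W₀(r) := 8·V_LJ(4^{1/6} r) = r⁻¹²/24 − r⁻⁶/3` one has POINTWISE on `(0,∞)`
`g ≥ (1 − μ)·V_LJ + μ·W₀` (`combo_le_g`: below `ρ` this reads `f ≤ μ(V_LJ − W₀) = μ(r⁻¹²/24 + r⁻⁶/6)`, true below
`ρ^{1/4}` because `f ≤ f 0 ≤ 135/ρ³ ≤ μr⁻⁶/6` there and on `[ρ^{1/4},ρ)` because `f ≤ 0`; beyond `ρ` both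
potentials are `≤ 0 = g`).  Summing over the pairs of an injective configuration and using `N·e* ≤ E_LJ(x)`
(`card_mul_eStar_le_interactionEnergy`, periodisation) and the tree's explicit stability
`−(2³²/12)·N ≤ E_LJ` applied to the DILATED configuration `4^{1/6} • x` (`le_interactionEnergy_lennardJones`) gives
`E_g(x) ≥ −c·N` with `c = −(1−μ)e* + μ·8·2³²/12`, so `c + f 0/2 ≤ −e* + μ(e* + 2³⁵/12) + 135/(2ρ³) ≤ −e* + K/ρ`
(`e* < 0` by the unit dimer).

No new definitions (the kernel and the truncations are lambdas); all `[folklore]`.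
-/

noncomputable section

namespace Summit.AtomisticToContinuum.Crystallization.Theorems.ThreeConeCertificateExactCertificate.Asymptotic

open Literature.MathematicalPhysics.StatisticalMechanics MeasureTheory Real Set
open Summit.AtomisticToContinuum.Crystallization.Theorems.ChargedEnergyGapNegative
  (E3 eStar eStar_le card_mul_eStar_le_interactionEnergy bddBelow_energyPerParticle_lennardJones
    dimer dimer_injective interactionEnergy_dimer)
open Summit.AtomisticToContinuum.Crystallization.Theorems.ThreeConeCertificateExactCertificate.Slackness
  (interactionEnergy_mono_pos)
open Summit.AtomisticToContinuum.Crystallization.Theorems.ExactCertificateNegative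
  (IsSplit interactionEnergy_add interactionEnergy_congr_pos)
open Summit.AtomisticToContinuum.Crystallization.Theorems.ThreeConeCertificateExactCertificate.Field
  (f_zero_nonneg abs_le_f_zero)
open scoped BigOperators

/-! ## Energies: linear combinations and dilations -/

/-- The energy is homogeneous in the potential. [folklore] -/
theorem interactionEnergy_const_mul (a : ℝ) (V : ℝ → ℝ) {N : ℕ} (x : Fin N → E3) :
    interactionEnergy (fun r => a * V r) x = a * interactionEnergy V x := by
  simp only [interactionEnergy, Finset.mul_sum]

/-- The energy of a dilated potential is the energy of the dilated configuration. [folklore] -/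
theorem interactionEnergy_dilate {s : ℝ} (hs : 0 < s) (V : ℝ → ℝ) {N : ℕ} (x : Fin N → E3) :
    interactionEnergy (fun r => V (s * r)) x = interactionEnergy V (fun i => s • x i) := by
  unfold interactionEnergy
  refine Finset.sum_congr rfl fun i _ => Finset.sum_congr rfl fun j _ => ?_
  rw [dist_smul₀, Real.norm_eq_abs, abs_of_pos hs]

/-- A dilation of an injective configuration is injective. [folklore] -/
theorem injective_dilate {s : ℝ} (hs : 0 < s) {N : ℕ} {x : Fin N → E3} (hx : Function.Injective x) :
    Function.Injective fun i => s • x i := fun _ _ h =>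
  hx (smul_right_injective E3 hs.ne' h)

/-! ## The softer Lennard-Jones potential `W₀ = 8·V_LJ(4^{1/6}·) = r⁻¹²/24 − r⁻⁶/3` -/

/-- The sixth root of `4`. [folklore] -/
theorem sixthRoot_four_pos : 0 < (4 : ℝ) ^ ((6 : ℕ)⁻¹ : ℝ) := Real.rpow_pos_of_pos (by norm_num) _

/-- `(4^{1/6})⁶ = 4`. [folklore] -/
theorem sixthRoot_four_pow : ((4 : ℝ) ^ ((6 : ℕ)⁻¹ : ℝ)) ^ 6 = 4 :=
  Real.rpow_inv_natCast_pow (by norm_num) (by norm_num)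

/-- `8·V_LJ(4^{1/6} r) = r⁻¹²/24 − r⁻⁶/3`. [folklore] -/
theorem eight_mul_lennardJones_dilate (r : ℝ) :
    8 * lennardJones ((4 : ℝ) ^ ((6 : ℕ)⁻¹ : ℝ) * r) = (r⁻¹) ^ 12 / 24 - (r⁻¹) ^ 6 / 3 := by
  set s : ℝ := (4 : ℝ) ^ ((6 : ℕ)⁻¹ : ℝ) with hs
  have h6 : s ^ 6 = 4 := sixthRoot_four_pow
  unfold lennardJones
  have e6 : ((s * r)⁻¹) ^ 6 = (r⁻¹) ^ 6 / 4 := by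
    rw [mul_inv, mul_pow, inv_pow, h6]; ring
  have e12 : ((s * r)⁻¹) ^ 12 = (r⁻¹) ^ 12 / 16 := by
    rw [show (12 : ℕ) = 6 * 2 from rfl, pow_mul, e6, pow_mul]; ring
  rw [e6, e12]; ring

/-- **Stability of `W₀`**: `−8·(2³²/12)·N ≤ E_{W₀}(x)` for injective `x` (the tree's explicit Lennard-Jones
stability applied to the dilated configuration). [folklore] -/
theorem soft_stable {N : ℕ} {x : Fin N → E3} (hx : Function.Injective x) :
    -(8 * (65536 ^ 2 / 12 : ℝ) * N) ≤
      interactionEnergy (fun r => 8 * lennardJones ((4 : ℝ) ^ ((6 : ℕ)⁻¹ : ℝ) * r)) x := by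
  rw [interactionEnergy_const_mul, interactionEnergy_dilate sixthRoot_four_pos]
  have h := le_interactionEnergy_lennardJones (d := 3) (by norm_num) N _ (injective_dilate sixthRoot_four_pos hx)
  linarith

/-! ## The pointwise comparison `(1 − μ)V_LJ + μW₀ ≤ g` -/

section Kernel

variable {ρ : ℝ} {f : ℝ → ℝ}

/-- **Pointwise domination.**  Let `ρ ≥ 1000`, `μ = 810/(ρ√ρ)`, and `f` with `|f| ≤ f 0 ≤ 135/ρ³` on `[0,∞)`,
`f ≤ 0` on `[ρ^{1/4}, ρ]`.  Then for every `r > 0`: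
`(1 − μ)·V_LJ(r) + μ·8V_LJ(4^{1/6} r) ≤ (V_LJ − f)1_{(0,ρ)}(r)`. [folklore] -/
theorem combo_le_g (hρ : 1000 ≤ ρ) (habs : ∀ r, 0 ≤ r → |f r| ≤ f 0) (h0 : f 0 ≤ 135 / ρ ^ 3)
    (hneg : ∀ d, Real.sqrt (Real.sqrt ρ) ≤ d → d ≤ ρ → f d ≤ 0) {r : ℝ} (hr : 0 < r) :
    (1 - 810 / (ρ * Real.sqrt ρ)) * lennardJones r +
        810 / (ρ * Real.sqrt ρ) * (8 * lennardJones ((4 : ℝ) ^ ((6 : ℕ)⁻¹ : ℝ) * r)) ≤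
      (if r < ρ then lennardJones r - f r else 0) := by
  have hρ0 : 0 < ρ := lt_of_lt_of_le (by norm_num) hρ
  have hsq1 : 1 ≤ Real.sqrt ρ := by
    rw [show (1 : ℝ) = Real.sqrt 1 from Real.sqrt_one.symm]
    exact Real.sqrt_le_sqrt (by linarith)
  have hsq0 : 0 < Real.sqrt ρ := by linarith
  have hρsq : 0 < ρ * Real.sqrt ρ := mul_pos hρ0 hsq0
  set μ : ℝ := 810 / (ρ * Real.sqrt ρ) with hμ
  have hμ0 : 0 ≤ μ := by rw [hμ]; positivity
  have hμ1 : μ ≤ 1 := by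
    rw [hμ, div_le_one hρsq]
    nlinarith
  rw [eight_mul_lennardJones_dilate]
  set t : ℝ := (r⁻¹) ^ 6 with ht
  have ht0 : 0 < t := by rw [ht]; positivity
  have h12 : (r⁻¹) ^ 12 = t ^ 2 := by rw [ht, ← pow_mul]
  have hV : lennardJones r = t ^ 2 / 12 - t / 6 := by
    unfold lennardJones; rw [h12, ht]; ring
  rw [hV, h12]
  by_cases hlt : r < ρ
  · rw [if_pos hlt]
    -- below the range: `f r ≤ μ (t²/24 + t/6)`
    suffices hf : f r ≤ μ * (t ^ 2 / 24 + t / 6) by nlinarith [hf]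
    by_cases hsmall : r < Real.sqrt (Real.sqrt ρ)
    · -- `f r ≤ f 0 ≤ 135/ρ³ ≤ μ t/6`
      have hfr : f r ≤ f 0 := (le_abs_self _).trans (habs r hr.le)
      have hr1 : r ^ 6 ≤ ρ * Real.sqrt ρ := by
        have h2 : r ^ 2 ≤ Real.sqrt ρ := by
          have := pow_le_pow_left₀ hr.le hsmall.le 2
          rwa [Real.sq_sqrt (Real.sqrt_nonneg _)] at this
        have h4 : r ^ 4 ≤ ρ := by
          have := pow_le_pow_left₀ (sq_nonneg r) h2 2
          rw [Real.sq_sqrt hρ0.le] at this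
          calc r ^ 4 = (r ^ 2) ^ 2 := by ring
            _ ≤ ρ := this
        calc r ^ 6 = r ^ 4 * r ^ 2 := by ring
          _ ≤ ρ * Real.sqrt ρ := mul_le_mul h4 h2 (sq_nonneg r) hρ0.le
      have htge : 1 / (ρ * Real.sqrt ρ) ≤ t := by
        rw [ht, inv_pow, ← one_div]
        exact one_div_le_one_div_of_le (by positivity) hr1
      have hkey : 135 / ρ ^ 3 ≤ μ * t / 6 := by
        have e1 : μ * (1 / (ρ * Real.sqrt ρ)) / 6 = 135 / ρ ^ 3 := by
          rw [hμ]
          have hs2 : Real.sqrt ρ * Real.sqrt ρ = ρ := Real.mul_self_sqrt hρ0.le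
          field_simp
          nlinarith [hs2]
        rw [← e1]
        have := mul_le_mul_of_nonneg_left htge hμ0
        linarith
      have : μ * t / 6 ≤ μ * (t ^ 2 / 24 + t / 6) := by nlinarith [sq_nonneg t]
      linarith
    · -- `f r ≤ 0`
      have hfr : f r ≤ 0 := hneg r (not_lt.1 hsmall) hlt.le
      have : 0 ≤ μ * (t ^ 2 / 24 + t / 6) := by positivity
      linarith
  · rw [if_neg hlt]
    -- beyond the range: both potentials are `≤ 0` (`t ≤ 1`)
    have hrρ : ρ ≤ r := not_lt.1 hlt
    have hr1 : 1 ≤ r := le_trans (by linarith) hrρ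
    have ht1 : t ≤ 1 := by
      rw [ht, inv_pow]
      exact inv_le_one_of_one_le₀ (one_le_pow₀ hr1)
    have hVle : t ^ 2 / 12 - t / 6 ≤ 0 := by nlinarith
    have hWle : t ^ 2 / 24 - t / 3 ≤ 0 := by nlinarith
    have hθ : 0 ≤ 1 - μ := by linarith
    nlinarith [mul_nonpos_of_nonneg_of_nonpos hθ hVle, mul_nonpos_of_nonneg_of_nonpos hμ0 hWle]

/-- **Stability of the truncated remainder** `g = (V_LJ − f)1_{(0,ρ)}` with the constant
`c = −(1 − μ)e* + μ·8·2³²/12`, `μ = 810/(ρ√ρ)`. [folklore] -/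
theorem stable_of_kernel (hρ : 1000 ≤ ρ) (habs : ∀ r, 0 ≤ r → |f r| ≤ f 0) (h0 : f 0 ≤ 135 / ρ ^ 3)
    (hneg : ∀ d, Real.sqrt (Real.sqrt ρ) ≤ d → d ≤ ρ → f d ≤ 0)
    {N : ℕ} {x : Fin N → E3} (hx : Function.Injective x) :
    -((-(1 - 810 / (ρ * Real.sqrt ρ)) * eStar + 810 / (ρ * Real.sqrt ρ) * (8 * (65536 ^ 2 / 12))) * N) ≤
      interactionEnergy (fun r => if r < ρ then lennardJones r - f r else 0) x := by
  set μ : ℝ := 810 / (ρ * Real.sqrt ρ) with hμ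
  have hρ0 : 0 < ρ := lt_of_lt_of_le (by norm_num) hρ
  have hsq1 : 1 ≤ Real.sqrt ρ := by
    rw [show (1 : ℝ) = Real.sqrt 1 from Real.sqrt_one.symm]
    exact Real.sqrt_le_sqrt (by linarith)
  have hρsq : 0 < ρ * Real.sqrt ρ := mul_pos hρ0 (by linarith)
  have hμ0 : 0 ≤ μ := by rw [hμ]; positivity
  have hμ1 : μ ≤ 1 := by
    rw [hμ, div_le_one hρsq]
    nlinarith
  -- sum the pointwise comparison over pairs
  have hmono := interactionEnergy_mono_pos
    (V := fun r => (1 - μ) * lennardJones r + μ * (8 * lennardJones ((4 : ℝ) ^ ((6 : ℕ)⁻¹ : ℝ) * r)))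
    (W := fun r => if r < ρ then lennardJones r - f r else 0)
    (fun r hr => combo_le_g hρ habs h0 hneg hr) hx
  have hsplit : interactionEnergy
      (fun r => (1 - μ) * lennardJones r + μ * (8 * lennardJones ((4 : ℝ) ^ ((6 : ℕ)⁻¹ : ℝ) * r))) x =
      (1 - μ) * interactionEnergy lennardJones x +
        μ * interactionEnergy (fun r => 8 * lennardJones ((4 : ℝ) ^ ((6 : ℕ)⁻¹ : ℝ) * r)) x := by
    rw [interactionEnergy_add, interactionEnergy_const_mul, interactionEnergy_const_mul]
  rw [hsplit] at hmono
  have h1 := card_mul_eStar_le_interactionEnergy bddBelow_energyPerParticle_lennardJones hx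
  have h2 := soft_stable hx
  have h3 : (1 - μ) * ((N : ℝ) * eStar) ≤ (1 - μ) * interactionEnergy lennardJones x :=
    mul_le_mul_of_nonneg_left h1 (by linarith)
  have h4 : μ * (-(8 * (65536 ^ 2 / 12 : ℝ) * N)) ≤
      μ * interactionEnergy (fun r => 8 * lennardJones ((4 : ℝ) ^ ((6 : ℕ)⁻¹ : ℝ) * r)) x :=
    mul_le_mul_of_nonneg_left h2 hμ0
  have e : -((-(1 - μ) * eStar + μ * (8 * (65536 ^ 2 / 12))) * (N : ℝ)) =
      (1 - μ) * ((N : ℝ) * eStar) + μ * (-(8 * (65536 ^ 2 / 12 : ℝ) * N)) := by ring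
  rw [e]
  linarith

/-- **The near-optimal split at range `ρ`.**  For `ρ ≥ 1000` and `f` radially of positive type with
`f 0 ≤ 135/ρ³`, `f ≤ 0` on `[ρ^{1/4}, ρ]`, `f ≤ V_LJ` on `[ρ,∞)`: the normal-form split `g = (V_LJ − f)1_{(0,ρ)}`,
`U = (V_LJ − f)1_{[ρ,∞)}` is a range-`ρ` three-cone split of value `≤ −e* + K/ρ`,
`K = 8·810·2³²/12 + 135`. [folklore] -/
theorem exists_split_of_kernel (hρ : 1000 ≤ ρ)
    (hpd : ∀ (n : ℕ) (y : Fin n → E3) (w : Fin n → ℝ), 0 ≤ ∑ i, ∑ j, w i * w j * f (dist (y i) (y j)))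
    (h0 : f 0 ≤ 135 / ρ ^ 3) (hneg : ∀ d, Real.sqrt (Real.sqrt ρ) ≤ d → d ≤ ρ → f d ≤ 0)
    (htail : ∀ d, ρ ≤ d → f d ≤ lennardJones d) :
    ∃ (c : ℝ) (g U : ℝ → ℝ), IsSplit ρ c g U f ∧
      c + f 0 / 2 ≤ -eStar + (8 * 810 * (65536 ^ 2 / 12) + 135) / ρ := by
  have hρ0 : 0 < ρ := lt_of_lt_of_le (by norm_num) hρ
  have hsq1 : 1 ≤ Real.sqrt ρ := by
    rw [show (1 : ℝ) = Real.sqrt 1 from Real.sqrt_one.symm]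
    exact Real.sqrt_le_sqrt (by linarith)
  have hρsq : 0 < ρ * Real.sqrt ρ := mul_pos hρ0 (by linarith)
  have habs : ∀ r, 0 ≤ r → |f r| ≤ f 0 := fun r hr => abs_le_f_zero hpd hr
  set μ : ℝ := 810 / (ρ * Real.sqrt ρ) with hμ
  have hμ0 : 0 ≤ μ := by rw [hμ]; positivity
  refine ⟨-(1 - μ) * eStar + μ * (8 * (65536 ^ 2 / 12)),
    fun r => if r < ρ then lennardJones r - f r else 0,
    fun r => if r < ρ then 0 else lennardJones r - f r, ⟨?_, ?_, ?_, hpd, ?_⟩, ?_⟩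
  · intro r _
    show lennardJones r =
      (if r < ρ then lennardJones r - f r else 0) + (if r < ρ then 0 else lennardJones r - f r) + f r
    by_cases h : r < ρ
    · rw [if_pos h, if_pos h]; ring
    · rw [if_neg h, if_neg h]; ring
  · intro r _
    show 0 ≤ (if r < ρ then 0 else lennardJones r - f r)
    by_cases h : r < ρ
    · rw [if_pos h]
    · rw [if_neg h, sub_nonneg]
      exact htail r (not_lt.1 h)
  · intro r hr
    show (if r < ρ then lennardJones r - f r else 0) = 0
    rw [if_neg (not_lt.2 hr)]
  · intro N x hx
    exact stable_of_kernel hρ habs h0 hneg hx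
  · -- the value: `μ e* ≤ 0`, `μ ≤ 810/ρ`, `f 0/2 ≤ 135/ρ`
    have he : eStar < 0 := by
      -- the unit dimer: `2·e* ≤ E_LJ(dimer) = −1/12`
      have h1 := card_mul_eStar_le_interactionEnergy bddBelow_energyPerParticle_lennardJones dimer_injective
      rw [interactionEnergy_dimer] at h1
      norm_num at h1
      linarith
    have hμle : μ ≤ 810 / ρ := by
      rw [hμ]
      exact div_le_div_of_nonneg_left (by norm_num) hρ0 (by nlinarith)
    have hρ1 : 1 ≤ ρ := le_trans (by norm_num) hρ
    have hf0 : f 0 / 2 ≤ 135 / ρ := by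
      have h3 : 135 / ρ ^ 3 ≤ 135 / ρ := by
        apply div_le_div_of_nonneg_left (by norm_num) hρ0
        nlinarith [pow_le_pow_right₀ hρ1 (show 1 ≤ 3 by norm_num)]
      have := f_zero_nonneg hpd
      linarith [pow_one ρ]
    have e1 : (8 * 810 * (65536 ^ 2 / 12) + 135) / ρ = (8 * (65536 ^ 2 / 12)) * (810 / ρ) + 135 / ρ := by
      field_simp
    rw [e1]
    have hμe : μ * eStar ≤ 0 := mul_nonpos_of_nonneg_of_nonpos hμ0 he.le
    nlinarith [hμle, hf0, hμe]

end Kernel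

/-! ## The registered stub -/

/-- **Registered stub `stub_splitOfKernel` of crux item stmt-AtomisticToContinuum-11959 (line
`closure-makes-nogap-exact`; signature verbatim): FROM A CHEAP BOCHNER CONE TO A NEAR-OPTIMAL SPLIT** — for
`ρ ≥ 1000` and `f` radially of positive type with `f 0 ≤ 135/ρ³`, `f ≤ 0` on `[ρ^{1/4}, ρ]`, `f ≤ V_LJ` on `[ρ,∞)`,
the normal-form split at range `ρ` has value `c + f 0/2 ≤ −e* + K/ρ`, `K = 8·810·2³²/12 + 135`
(`exists_split_of_kernel`).  Fed with the kernels `f_ρ` of `…AsymptoticKernel` (c1, p107933) this is the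
asymptotic no-gap `stub_asymptoticNoGap`; it is kernel-agnostic, so any better-designed cone family gives a
better rate. [folklore] -/
theorem stub_splitOfKernel : ∀ (ρ : ℝ) (f : ℝ → ℝ), 1000 ≤ ρ →
    (∀ (n : ℕ) (y : Fin n → EuclideanSpace ℝ (Fin 3)) (w : Fin n → ℝ),
      0 ≤ ∑ i, ∑ j, w i * w j * f (dist (y i) (y j))) →
    f 0 ≤ 135 / ρ ^ 3 → (∀ d : ℝ, Real.sqrt (Real.sqrt ρ) ≤ d → d ≤ ρ → f d ≤ 0) →
    (∀ d : ℝ, ρ ≤ d → f d ≤ lennardJones d) →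
    ∃ (c : ℝ) (g U : ℝ → ℝ), Summit.AtomisticToContinuum.Crystallization.Theorems.ExactCertificateNegative.IsSplit ρ c g U f ∧
      c + f 0 / 2 ≤ -Summit.AtomisticToContinuum.Crystallization.Theorems.ChargedEnergyGapNegative.eStar +
        (8 * 810 * (65536 ^ 2 / 12) + 135) / ρ :=
  fun _ _ hρ hpd h0 hneg htail => exists_split_of_kernel hρ hpd h0 hneg htail

end Summit.AtomisticToContinuum.Crystallization.Theorems.ThreeConeCertificateExactCertificate.Asymptotic

end
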